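import Summits.QuantumFields.YangMills.Theorems.BalabanUVNodesN24LineTwoRung1AtThm1CCMWZDoorOfChildrenSlotLetter
import Summits.QuantumFields.YangMills.Theorems.BalabanUVNodesK0NamedZWitnessOfStepTokensGuarded
import Summits.QuantumFields.YangMills.Theorems.BalabanUVNodesK0V20GDefs

/-!
# NODE N24 (B2) — FLAG №9 (4) ON K0⁷'s SKELETON OF RECORD «V20-G»: the LINE-2′ closer AT THE z-WITNESS `θ₁₅ᶜᶜᴹᵂᶻ(j; γ; Efl, logz)` WITH THE K0 FACE IN THE REGISTERED V20-G TEXTS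
# (`K0V20GDefs.Prop8StepCoPGAt`, `…AbsBetaBoxAtThm1WitnessCCMGenGAt`) AND ROAD-FREE («box-letter») CHILDREN FAMILIES — `K1V10Defs.NodesAtSomeRecord13PWSVW`, the registered
# `stub_nodes13PWSVW` type, K1⁹ BY NAME

TRACK A (YM-PLAN §2d, node N24 = binder B2, composite), seat `pub-ymgap-dag-n24-c` (R134 s2; gen 12, Part 45); `--supports` K1⁹ stmt-QuantumFields-27364 as a helper; count-neutral.
WHY.  Part 44 (`…N24LineTwoRung1AtThm1CCMWZDoorOfChildrenSlotLetter`, p641655) re-keyed the LINE-2′ closer at DEF-1's z-witness with the K0 face in V19's texts and the children families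
carrying the R-road door letters `(h15 : VariationalThm1RegSepCoP7M …) (hc) (h9 : Gauge9RegSepTopStepR …)` of Part 14.  K0⁷'s skeleton OF RECORD is now «V20-G» (plan g86, dead8a8df885c226:
`stub_prop8StepCoPG13 : ∀ F, Prop8StepCoPGAt F`, `stub_absBetaBoxAtThm1WitnessCCMGenG13 : ∀ F, AbsBetaBoxAtThm1WitnessCCMGenGAt F`), whose stub 1 is WEAKER than V19's
(`K0V20GDefs.prop8StepCoPGAt_of_V19`) — so a by-name proof of the registered K0 stubs would NOT feed Part 44.  THIS FILE is the twin a K0 closure of record feeds: (i) the K0 FACE is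
V20-G's two open texts BY NAME (stub 2′ discharged by k0-s2-w1's `K0Stub2PrimeHolds.prop6MemberB8AtP_holds`), the door tuple `(j, c′, c₀, B₃, B₉, a₀, a₁′)` extracted as in
`K0PrintCubeOfStepTokensGuarded` ∕ `K0NamedZWitnessOfStepTokensGuarded` (`gauge9SupplierG_of_prop6MemberP`, `variationalThm1RegSepCoP7MG_of_prop8TopStepG`), the window letters by
`windowLetters_of_absBetaBoxH` + `betaLowerH∕UpperH_theta13OfThm1CCMW_of_half` (the |β|-box is E-free, so it IS the box at the z-witness by unfolding) and (hcomp) ∧ (hcompRev) by dag-n21-c's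
`hcompBoth_theta13OfThm1CCMW_of_betaBoxSignFree`; (ii) the FOUR DOOR ROWS at `ofHistoryBlind (ofCured θ₁₅ᶜᶜᴹᵂᶻ)` from k0-s1-w3 g7's `K0NamedZWitnessOfStepTokensGuarded.k0SepCoPHAt_ofHistoryBlind_ofCured_theta13OfThm1CCMWZ`
(provisos ∧ unity ∧ slots ∧ admissible on the G road, p6417xx) + this seat's `N24_laws_door_theta13OfThm1CCMWZ` (Part 43, p641309); (iii) the CHILDREN FAMILIES ARE ROAD-FREE: their binders
are the window + six signs + the sign-free β-box letters `(hbox hbox' hl hβ')` ONLY (what N09∕N11∕N12's suppliers actually read — N12's live-mass road reads `hbox'`, `hβ'`), with NO (8)∕(9)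
letter; the three world∕revision-quantified families (N10's `h09T`, N11's `h11`, N13's slot letter `h13`) take the door provisos `hP` as a BINDER (any proof: `datumOfRecord₁₃SepCoPH θ hP` is
proof-irrelevant).  Hence ONE closer shape serves every K0 road (V19 ∕ V20-R ∕ V20-G) and every witness edition; the engine is p639124's door-free `N24_nodesAtSomeRecord13PWSVW_byName_atWitness`.
The normalisation letters `(Efl, logz)` are FREE PARAMETERS (№218: not the blind `0∕0`).

CONTENTS (theorems only; 0 `sorry`, 0 `def`, no `instance`, no `notation`; composition BY NAME):
* §1 ★★ `N24_nodesAtSomeRecord13PWSVW_byName_theta13OfThm1CCMWZ_doorG_of_stub1G_stub3A'G_of_children_boxLetters` (per `F`, letters `Efl logz`).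
* §2 ★★★ `N24_stub_nodes13PWSVW_text_theta13OfThm1CCMWZ_doorG_of_openStubsG_of_children_boxLetters` — THE REGISTERED v10 STUB TYPE `∀ F, Inhabited13 F → NodesAtSomeRecord13PWSVW F` from the
  two OPEN V20-G stub texts BY NAME + the road-free children families at the z-witness.
* §3 ★★★ `N24_stabilityBRunRowsAtRecordR13SepCoPHV_byName_theta13OfThm1CCMWZ_doorG_…_of_stub2VW_stub3VW` — + the two registered β-side VW texts ⊢ K1⁹ BY NAME (W-END road p638487).
HONEST FRAMING: composition BY NAME; NO estimate; nothing of Bałaban's asserted; every family DISPLAYED; CONDITIONAL (audit `proof.conditional`); NO stub of v10 ∕ V20-G proved or closed;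
N05–N13 NOT discharged; N24 COMPOSITE — no count moved (typed 28∕28 · discharged 5∕27 · A 5∕28); K0⁷ ∕ K1⁹ (DECIDING) ∕ K3⁸ OPEN; FLAG №9 closes only on the director's word after a referee PASS;
R4 = the conditional finite-𝕋⁴ rung `BalabanLadder.UV` only — NOT continuum ∕ ℝ⁴ ∕ OS ∕ mass gap ∕ Clay: the Yang–Mills mass gap is NOT proved by any of this.
Sources (statement shapes only): [Balaban1989LargeFieldII] Thm 1 p.355, (0.1) pp.355–356, p.391; [Balaban1988Convergent] (0.2) p.244, (1.15) p.249, Cor. 3 (2.50) p.264, Thm 1 p.262;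
[Balaban1987RG1] (0.15) p.254, Thm 1 p.255, Thm 3 p.264, Lemma 4 p.280, (0.17)–(0.21) pp.255–256, §1 pp.263–264; [Balaban1985Variational] Thm 1 (8)–(9) p.279, Prop. 8 p.304;
[Balaban1985RegularSpaces] Prop. 6 p.99, Prop. 7 (1.145) p.100, Thm 8 (1.146) p.101; [Balaban1985UV3] Thm 1 p.257, Thm 2 p.272; [Balaban1989LargeFieldI] (0.2)–(0.6) p.176, (1.2) p.178, Prop. 1 p.194.
-/

noncomputable section

open scoped Matrix.Norms.L2Operator BigOperators

namespace Summit.QuantumFields.YangMills.BalabanUVNodes.N24LineTwoRung1AtThm1CCMWZDoorGOfChildrenBoxLetters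

open Literature.MathematicalPhysics.QuantumFieldTheory.Balaban1983to89
open Literature.MathematicalPhysics.QuantumFieldTheory.Balaban1983to89.Node00
open DagBinding T4Continuum T4DatumAssembly FlowStepRuns AveragingRT
open FlowStep (BetaLowerH BetaUpperH RGEqH prefixOf)
open Summit.QuantumFields.YangMills.BalabanUVNodes.N07Thm1Top7FromProp8 (variationalThm1RegSepCoP7MG_of_prop8TopStepG)
open Summit.QuantumFields.YangMills.Theorems.K0PrintCubeOfStepTokensGuarded (gauge9SupplierG_of_prop6MemberP)
open Summit.QuantumFields.YangMills.Theorems.K0NamedZWitnessOfStepTokensGuarded (k0SepCoPHAt_ofHistoryBlind_ofCured_theta13OfThm1CCMWZ)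
open Summit.QuantumFields.YangMills.BalabanUVNodes.N24K1ConsequentOfStubsV19AndChildren (windowLetters_of_absBetaBoxH)
open Summit.QuantumFields.YangMills.Theorems.K0V20GDefs (Prop8StepCoPGAt AbsBetaBoxAtThm1WitnessCCMGenGAt)
open Summit.QuantumFields.YangMills.Theorems.K1V6Defs (Inhabited13)
open Summit.QuantumFields.YangMills.Theorems.K1V10Defs (NodesAtSomeRecord13PWSVW RunRowsAtSomeRecord13PWSVW RunRowsContAtSomeRecord13PWSVW)
open Summit.QuantumFields.YangMills.BalabanUVNodes.N24LineTwoRung1AtAbstractWitnessOfChildrenSlotLetter (N24_nodesAtSomeRecord13PWSVW_byName_atWitness)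
open Summit.QuantumFields.YangMills.BalabanUVNodes.K1R9BodyAtRevisedRecordWorldOfNodesWRunLetters (stabilityBRunRowsAtRecordR13SepCoPHV_of_stubTextsVW)

variable {F : T4Family}

/-! ## §1. `N = 2`, per `F`, letters `(Efl, logz)`: rung 1ⱽᵂ BY NAME at the z-witness from V20-G's stub 1 ∧ 3ᴬ′-G texts and road-free children families -/

/-- **★★ LINE 2′'s RUNG 1ⱽᵂ BY NAME AT `F` FROM V20-G's STUB 1-G ∧ 3ᴬ′-G TEXTS AND ROAD-FREE CHILDREN FAMILIES AT THE z-WITNESS** — K0 face: `Prop8StepCoPGAt F`, `AbsBetaBoxAtThm1WitnessCCMGenGAt F`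
(stub 2′ by name); door tuple and window exactly as in `K0NamedZWitnessOfStepTokensGuarded` §3 ∕ Part 44 §1; the four door rows at `ofHistoryBlind (ofCured θ₁₅ᶜᶜᴹᵂᶻ)` from k0-s1-w3's
`k0SepCoPHAt_ofHistoryBlind_ofCured_theta13OfThm1CCMWZ` + `N24_laws_door_theta13OfThm1CCMWZ`; the children families carry ONLY the window, the six signs and the β-box letters (+ the door
provisos `hP` as a binder where the datum is read); engine p639124.  CONDITIONAL display; no stub closed; nothing of Bałaban asserted. [cite: Balaban1989LargeFieldII, Thm 1 p.355, (0.1) pp.355–356, p.391; Balaban1988Convergent, (0.2) p.244, (1.15) p.249, Cor. 3 (2.50) p.264; Balaban1987RG1, (0.15) p.254, Thm 3 p.264, Lemma 4 p.280, (0.17)–(0.20) pp.255–256; Balaban1985Variational, Thm 1 (8)–(9) p.279, Prop. 8 p.304; Balaban1985RegularSpaces, Prop. 6 p.99, Prop. 7 (1.145) p.100, Thm 8 (1.146) p.101; Balaban1985UV3, Thm 1 p.257; Balaban1989LargeFieldI, (0.2)–(0.6) p.176, Prop. 1 p.194 (bookkeeping)] -/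
theorem N24_nodesAtSomeRecord13PWSVW_byName_theta13OfThm1CCMWZ_doorG_of_stub1G_stub3A'G_of_children_boxLetters (Efl logz : B12.RunParams → ℕ → ℝ)
    (h1G : Prop8StepCoPGAt F) (h3A'G : AbsBetaBoxAtThm1WitnessCCMGenGAt F)
    (h05F : ∀ {j : ℕ} {γ ε₀ ε₂₉ B₃ B₃' a₀ a₁ : ℝ} (hγ₀ : 0 < γ) (hγh : γ ≤ 1 / 2) (hε : 0 < ε₀) (hε' : 0 < ε₂₉) (hB : 0 ≤ B₃) (hB' : 0 ≤ B₃') (ha₀ : 0 < a₀) (ha₁ : 0 < a₁) {bl β' : ℝ} (hbox : BetaLowerH bl γ (betaOfRecord₁₃ F 2 (theta13OfThm1CCMWZ F 2 j γ ε₀ ε₂₉ B₃ B₃' a₀ a₁ Efl logz))) (hbox' : BetaUpperH β' γ (betaOfRecord₁₃ F 2 (theta13OfThm1CCMWZ F 2 j γ ε₀ ε₂₉ B₃ B₃' a₀ a₁ Efl logz))) (hl : -bl * γ ^ 2 ≤ 3) (hβ' : β' * γ ^ 2 ≤ 3 / 4),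
      ∃ lam8 : ResidB8 (theta13OfThm1CCMWZ F 2 j γ ε₀ ε₂₉ B₃ B₃' a₀ a₁ Efl logz).toStage3Params, B8LeafOfRecordSubBP (theta13OfThm1CCMWZ F 2 j γ ε₀ ε₂₉ B₃ B₃' a₀ a₁ Efl logz).toStage3Params lam8)
    (h06F : ∀ {j : ℕ} {γ ε₀ ε₂₉ B₃ B₃' a₀ a₁ : ℝ} (hγ₀ : 0 < γ) (hγh : γ ≤ 1 / 2) (hε : 0 < ε₀) (hε' : 0 < ε₂₉) (hB : 0 ≤ B₃) (hB' : 0 ≤ B₃') (ha₀ : 0 < a₀) (ha₁ : 0 < a₁) {bl β' : ℝ} (hbox : BetaLowerH bl γ (betaOfRecord₁₃ F 2 (theta13OfThm1CCMWZ F 2 j γ ε₀ ε₂₉ B₃ B₃' a₀ a₁ Efl logz))) (hbox' : BetaUpperH β' γ (betaOfRecord₁₃ F 2 (theta13OfThm1CCMWZ F 2 j γ ε₀ ε₂₉ B₃ B₃' a₀ a₁ Efl logz))) (hl : -bl * γ ^ 2 ≤ 3) (hβ' : β' * γ ^ 2 ≤ 3 / 4),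
      ∃ (Mstar : ℕ) (ops : OpsY 2 (theta13OfThm1CCMWZ F 2 j γ ε₀ ε₂₉ B₃ B₃' a₀ a₁ Efl logz).toStage3Params Mstar), B9LeafX (Y9OfRecord 2 (theta13OfThm1CCMWZ F 2 j γ ε₀ ε₂₉ B₃ B₃' a₀ a₁ Efl logz).toStage3Params Mstar ops))
    (h07 : ∃ ζ : ResidZ F 2, B11Leaf (Z11OfRecord F 2 ζ))
    (h08 : PrintedUV3V 2 F.L)
    (h09F : ∀ {j : ℕ} {γ ε₀ ε₂₉ B₃ B₃' a₀ a₁ : ℝ} (hγ₀ : 0 < γ) (hγh : γ ≤ 1 / 2) (hε : 0 < ε₀) (hε' : 0 < ε₂₉) (hB : 0 ≤ B₃) (hB' : 0 ≤ B₃') (ha₀ : 0 < a₀) (ha₁ : 0 < a₁) {bl β' : ℝ} (hbox : BetaLowerH bl γ (betaOfRecord₁₃ F 2 (theta13OfThm1CCMWZ F 2 j γ ε₀ ε₂₉ B₃ B₃' a₀ a₁ Efl logz))) (hbox' : BetaUpperH β' γ (betaOfRecord₁₃ F 2 (theta13OfThm1CCMWZ F 2 j γ ε₀ ε₂₉ B₃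 B₃' a₀ a₁ Efl logz))) (hl : -bl * γ ^ 2 ≤ 3) (hβ' : β' * γ ^ 2 ≤ 3 / 4),
      ∃ lam12 : ResidB12 F 2 (theta13OfThm1CCMWZ F 2 j γ ε₀ ε₂₉ B₃ B₃' a₀ a₁ Efl logz).τ9.M,
      ∀ P : B12.RunParams, B12Sec2to5.Lemma4Printed (F12OfRecord₁₂ F 2 (theta13OfThm1CCMWZ F 2 j γ ε₀ ε₂₉ B₃ B₃' a₀ a₁ Efl logz).toStage12Params lam12 P) (lam12 P).consts)
    (h09TF : ∀ {j : ℕ} {γ ε₀ ε₂₉ B₃ B₃' a₀ a₁ : ℝ} (hγ₀ : 0 < γ) (hγh : γ ≤ 1 / 2) (hε : 0 < ε₀) (hε' : 0 < ε₂₉) (hB : 0 ≤ B₃) (hB' : 0 ≤ B₃') (ha₀ : 0 < a₀) (ha₁ : 0 < a₁) {bl β' : ℝ} (hbox : BetaLowerH bl γ (betaOfRecord₁₃ F 2 (theta13OfThm1CCMWZ F 2 j γ ε₀ ε₂₉ B₃ B₃' a₀ a₁ Efl logz))) (hbox' : BetaUpperH β' γ (betaOfRecord₁₃ F 2 (theta13OfThm1CCMWZ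 F 2 j γ ε₀ ε₂₉ B₃ B₃' a₀ a₁ Efl logz))) (hl : -bl * γ ^ 2 ≤ 3) (hβ' : β' * γ ^ 2 ≤ 3 / 4)
      (hP : (Stage13HParams.ofHistoryBlind F 2 (Stage13RParams.ofCured F 2 (theta13OfThm1CCMWZ F 2 j γ ε₀ ε₂₉ B₃ B₃' a₀ a₁ Efl logz))).Provisos₁₃SepCoPH F 2),
      ∃ γ₉ : ℝ, 0 < γ₉ ∧ ∀ w : WorldP, w.C = (datumOfRecord₁₃SepCoPH F 2 (Stage13HParams.ofHistoryBlind F 2 (Stage13RParams.ofCured F 2 (theta13OfThm1CCMWZ F 2 j γ ε₀ ε₂₉ B₃ B₃' a₀ a₁ Efl logz))) hP).C →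
      w.γ ≤ γ₉ → ∀ P : B12.RunParams, (leavesP w P).smallCouplings → (leavesP w P).smallFieldInductive)
    (h10F : ∀ {j : ℕ} {γ ε₀ ε₂₉ B₃ B₃' a₀ a₁ : ℝ} (hγ₀ : 0 < γ) (hγh : γ ≤ 1 / 2) (hε : 0 < ε₀) (hε' : 0 < ε₂₉) (hB : 0 ≤ B₃) (hB' : 0 ≤ B₃') (ha₀ : 0 < a₀) (ha₁ : 0 < a₁) {bl β' : ℝ} (hbox : BetaLowerH bl γ (betaOfRecord₁₃ F 2 (theta13OfThm1CCMWZ F 2 j γ ε₀ ε₂₉ B₃ B₃' a₀ a₁ Efl logz))) (hbox' : BetaUpperH β' γ (betaOfRecord₁₃ F 2 (theta13OfThm1CCMWZ F 2 j γ ε₀ ε₂₉ B₃ B₃' a₀ a₁ Efl logz))) (hl : -bl * γ ^ 2 ≤ 3) (hβ' : β' * γ ^ 2 ≤ 3 / 4),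
      ∃ lam13 : B12.RunParams → ResidB13 (theta13OfThm1CCMWZ F 2 j γ ε₀ ε₂₉ B₃ B₃' a₀ a₁ Efl logz).toStage3Params,
      ∀ P : B12.RunParams, B13LeafOfRecord (theta13OfThm1CCMWZ F 2 j γ ε₀ ε₂₉ B₃ B₃' a₀ a₁ Efl logz).toStage3Params (lam13 P))
    (h11F : ∀ {j : ℕ} {γ ε₀ ε₂₉ B₃ B₃' a₀ a₁ : ℝ} (hγ₀ : 0 < γ) (hγh : γ ≤ 1 / 2) (hε : 0 < ε₀) (hε' : 0 < ε₂₉) (hB : 0 ≤ B₃) (hB' : 0 ≤ B₃') (ha₀ : 0 < a₀) (ha₁ : 0 < a₁) {bl β' : ℝ} (hbox : BetaLowerH bl γ (betaOfRecord₁₃ F 2 (theta13OfThm1CCMWZ F 2 j γ ε₀ ε₂₉ B₃ B₃' a₀ a₁ Efl logz))) (hbox' : BetaUpperH β' γ (betaOfRecord₁₃ F 2 (theta13OfThm1CCMWZ F 2 j γ ε₀ ε₂₉ B₃ B₃' a₀ a₁ Efl logz))) (hl : -bl * γ ^ 2 ≤ 3) (hβ' : β' * γ ^ 2 ≤ 3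 / 4)
      (hP : (Stage13HParams.ofHistoryBlind F 2 (Stage13RParams.ofCured F 2 (theta13OfThm1CCMWZ F 2 j γ ε₀ ε₂₉ B₃ B₃' a₀ a₁ Efl logz))).Provisos₁₃SepCoPH F 2),
      ∀ βup β₀ : ℝ, ∃ γ₁₁ : ℝ, 0 < γ₁₁ ∧ ∀ w : WorldP, w.C = (datumOfRecord₁₃SepCoPH F 2 (Stage13HParams.ofHistoryBlind F 2 (Stage13RParams.ofCured F 2 (theta13OfThm1CCMWZ F 2 j γ ε₀ ε₂₉ B₃ B₃' a₀ a₁ Efl logz))) hP).C →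
      w.βup = βup → w.β₀ = β₀ → w.γ ≤ γ₁₁ → ∀ P : B12.RunParams, (leavesP w P).b7 → (leavesP w P).b8 → (leavesP w P).b9 → (leavesP w P).b10 → (leavesP w P).b11 →
      (leavesP w P).smallCouplings → (leavesP w P).smallFieldInductive → (leavesP w P).flowControl →
        ∀ k, k < P.K → SLaw₁₃CoPH F 2 (Stage13HParams.ofHistoryBlind F 2 (Stage13RParams.ofCured F 2 (theta13OfThm1CCMWZ F 2 j γ ε₀ ε₂₉ B₃ B₃' a₀ a₁ Efl logz))) P k → TLaw₁₃CoPH F 2 (Stage13HParams.ofHistoryBlind F 2 (Stage13RParams.ofCured F 2 (theta13OfThm1CCMWZ F 2 j γ ε₀ ε₂₉ B₃ B₃' a₀ a₁ Efl logz))) P k)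
    (h12F : ∀ {j : ℕ} {γ ε₀ ε₂₉ B₃ B₃' a₀ a₁ : ℝ} (hγ₀ : 0 < γ) (hγh : γ ≤ 1 / 2) (hε : 0 < ε₀) (hε' : 0 < ε₂₉) (hB : 0 ≤ B₃) (hB' : 0 ≤ B₃') (ha₀ : 0 < a₀) (ha₁ : 0 < a₁) {bl β' : ℝ} (hbox : BetaLowerH bl γ (betaOfRecord₁₃ F 2 (theta13OfThm1CCMWZ F 2 j γ ε₀ ε₂₉ B₃ B₃' a₀ a₁ Efl logz))) (hbox' : BetaUpperH β' γ (betaOfRecord₁₃ F 2 (theta13OfThm1CCMWZ F 2 j γ ε₀ ε₂₉ B₃ B₃' a₀ a₁ Efl logz))) (hl : -bl * γ ^ 2 ≤ 3) (hβ' : β' * γ ^ 2 ≤ 3 / 4),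
      ∃ lamW : ResidW F 2, (∀ P : B12.RunParams, B15Leaf (WOfRecord₁₃ F 2 (theta13OfThm1CCMWZ F 2 j γ ε₀ ε₂₉ B₃ B₃' a₀ a₁ Efl logz) lamW P)) ∧
      ∀ P : B12.RunParams, 1 ≤ P.K → lamW.kSel P < P.K)
    (h13F : ∀ {j : ℕ} {γ ε₀ ε₂₉ B₃ B₃' a₀ a₁ : ℝ} (hγ₀ : 0 < γ) (hγh : γ ≤ 1 / 2) (hε : 0 < ε₀) (hε' : 0 < ε₂₉) (hB : 0 ≤ B₃) (hB' : 0 ≤ B₃') (ha₀ : 0 < a₀) (ha₁ : 0 < a₁) {bl β' : ℝ} (hbox : BetaLowerH bl γ (betaOfRecord₁₃ F 2 (theta13OfThm1CCMWZ F 2 j γ ε₀ ε₂₉ B₃ B₃' a₀ a₁ Efl logz))) (hbox' : BetaUpperH β' γ (betaOfRecord₁₃ F 2 (theta13OfThm1CCMWZ F 2 j γ ε₀ ε₂₉ B₃ B₃' a₀ a₁ Efl logz))) (hl : -bl * γ ^ 2 ≤ 3) (hβ' : β' * γ ^ 2 ≤ 3 / 4)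
      (hP : (Stage13HParams.ofHistoryBlind F 2 (Stage13RParams.ofCured F 2 (theta13OfThm1CCMWZ F 2 j γ ε₀ ε₂₉ B₃ B₃' a₀ a₁ Efl logz))).Provisos₁₃SepCoPH F 2),
      ∃ γ₁₃ : ℝ, 0 < γ₁₃ ∧ ∃ em ep : ℝ → ℝ, ∃ v : Revision₁₃ F 2 (Stage13HParams.ofHistoryBlind F 2 (Stage13RParams.ofCured F 2 (theta13OfThm1CCMWZ F 2 j γ ε₀ ε₂₉ B₃ B₃' a₀ a₁ Efl logz))) hP,
      ∀ P : B12.RunParams, (genFlow (betaOfRecord₁₃ F 2 (theta13OfThm1CCMWZ F 2 j γ ε₀ ε₂₉ B₃ B₃' a₀ a₁ Efl logz)) P.g0).InInterval γ₁₃ P.K → ∀ k, k ≤ P.K → SLaw₁₃CoPH F 2 (Stage13HParams.ofHistoryBlind F 2 (Stage13RParams.ofCured F 2 (theta13OfThm1CCMWZ F 2 j γ ε₀ ε₂₉ B₃ B₃' a₀ a₁ Efl logz))) P k →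
      ∀ U : GaugeField (F.P P.K) k (SU 2),
        chiβOfRecord₁₃ F 2 (theta13OfThm1CCMWZ F 2 j γ ε₀ ε₂₉ B₃ B₃' a₀ a₁ Efl logz) P.K (gOfRecord₁₃ F 2 (theta13OfThm1CCMWZ F 2 j γ ε₀ ε₂₉ B₃ B₃' a₀ a₁ Efl logz) P) k U *
              Real.exp (-(1 / (gOfRecord₁₃ F 2 (theta13OfThm1CCMWZ F 2 j γ ε₀ ε₂₉ B₃ B₃' a₀ a₁ Efl logz) P k) ^ 2 * wilsonBGOfRecord F 2 (theta13OfThm1CCMWZ F 2 j γ ε₀ ε₂₉ B₃ B₃' a₀ a₁ Efl logz).εbg P k U)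
                - em (gOfRecord₁₃ F 2 (theta13OfThm1CCMWZ F 2 j γ ε₀ ε₂₉ B₃ B₃' a₀ a₁ Efl logz) P k) * (Fintype.card (Site (F.P P.K) k) : ℝ)) ≤ v.ρ P k U ∧
        v.ρ P k U ≤ Real.exp (ep (gOfRecord₁₃ F 2 (theta13OfThm1CCMWZ F 2 j γ ε₀ ε₂₉ B₃ B₃' a₀ a₁ Efl logz) P k) * (Fintype.card (Site (F.P P.K) k) : ℝ))) :
    NodesAtSomeRecord13PWSVW F := by
  obtain ⟨c, c₀, B₃, a₀, a₁, hB₃, ha₀, ha₁, h8⟩ := h1G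
  have hL0 : (0 : ℝ) < (F.L : ℝ) := by exact_mod_cast lt_trans Nat.zero_lt_one F.hL.2
  have hBpos : (0 : ℝ) < B₃ := lt_of_lt_of_le (mul_pos two_pos (pow_pos hL0 2)) hB₃
  obtain ⟨j, c', B₉, a₁', hcc', hc', hc₀, hB9, ha₁', ha₁'le, h9⟩ :=
    gauge9SupplierG_of_prop6MemberP F (Summit.QuantumFields.YangMills.Theorems.K0Stub2PrimeHolds.prop6MemberB8AtP_holds F) c c₀ B₃ a₀ a₁ hB₃ ha₀ ha₁ h8
  have h15 : VariationalThm1RegSepCoP7MG F 2 (fun ν _M _g K k _s => c' ≤ ν.M₁ ∧ k + c₀ ≤ F.m + K) B₃ a₀ a₁' :=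
    (variationalThm1RegSepCoP7MG_of_prop8TopStepG hBpos (h8.of_le le_rfl ha₁'le)).of_imp fun _ _ _ _ _ _ h => ⟨hcc'.trans h.1, h.2⟩
  obtain ⟨γ₀, ε₀, ε₂₉, β', hγ0, hε, hε', hlow, hup⟩ := h3A'G j c' c₀ B₃ B₉ a₀ a₁' hc' hc₀ hB₃ hB9 ha₀ ha₁' h15 h9
  obtain ⟨γ, hγpos, hγh, hl, hu, hlow', hup'⟩ := windowLetters_of_absBetaBoxH hγ0 hlow hup
  have hloW := betaLowerH_theta13OfThm1CCMW_of_half (F := F) (N := 2) (j := j) (ε₀ := ε₀) (ε₂₉ := ε₂₉) (B₃ := B₃) (B₃' := B₉) (a₀ := a₀) (a₁ := a₁') hγh hlow'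
  have hupW := betaUpperH_theta13OfThm1CCMW_of_half (F := F) (N := 2) (j := j) (ε₀ := ε₀) (ε₂₉ := ε₂₉) (B₃ := B₃) (B₃' := B₉) (a₀ := a₀) (a₁ := a₁') hγh hup'
  have hloZ : BetaLowerH _ γ (betaOfRecord₁₃ F 2 (theta13OfThm1CCMWZ F 2 j γ ε₀ ε₂₉ B₃ B₉ a₀ a₁' Efl logz)) := hloW
  have hupZ : BetaUpperH _ γ (betaOfRecord₁₃ F 2 (theta13OfThm1CCMWZ F 2 j γ ε₀ ε₂₉ B₃ B₉ a₀ a₁' Efl logz)) := hupW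
  have H := hcompBoth_theta13OfThm1CCMW_of_betaBoxSignFree (F := F) (N := 2) (j := j) (ε₀ := ε₀) (ε₂₉ := ε₂₉) hγh hBpos.le hB9.le ha₀.le ha₁'.le hloW hupW hl hu
  obtain ⟨hP, hU, hA⟩ := k0SepCoPHAt_ofHistoryBlind_ofCured_theta13OfThm1CCMWZ (Efl := Efl) (logz := logz) hγpos hγh hε hε' hBpos.le hB9.le ha₀ ha₁' hc' hc₀ h15
    (variationalThm1GaugeRegSepCoP7MG_of_gauge9TopStepG h9) H.1 H.2
  exact N24_nodesAtSomeRecord13PWSVW_byName_atWitness (Stage13HParams.ofHistoryBlind F 2 (Stage13RParams.ofCured F 2 (theta13OfThm1CCMWZ F 2 j γ ε₀ ε₂₉ B₃ B₉ a₀ a₁' Efl logz))) hP hA hU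
    (N24_laws_door_theta13OfThm1CCMWZ Efl logz hγpos hγh hε hε' hBpos.le hB9.le ha₀ ha₁')
    (h05F hγpos hγh hε hε' hBpos.le hB9.le ha₀ ha₁' hloZ hupZ hl hu) (h06F hγpos hγh hε hε' hBpos.le hB9.le ha₀ ha₁' hloZ hupZ hl hu) h07 h08
    (h09F hγpos hγh hε hε' hBpos.le hB9.le ha₀ ha₁' hloZ hupZ hl hu) (h09TF hγpos hγh hε hε' hBpos.le hB9.le ha₀ ha₁' hloZ hupZ hl hu hP)
    (h10F hγpos hγh hε hε' hBpos.le hB9.le ha₀ ha₁' hloZ hupZ hl hu) (h11F hγpos hγh hε hε' hBpos.le hB9.le ha₀ ha₁' hloZ hupZ hl hu hP)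
    (h12F hγpos hγh hε hε' hBpos.le hB9.le ha₀ ha₁' hloZ hupZ hl hu) (h13F hγpos hγh hε hε' hBpos.le hB9.le ha₀ ha₁' hloZ hupZ hl hu hP)

/-! ## §2. ★★★ THE REGISTERED STUB TYPE from V20-G's two OPEN stub texts BY NAME and the road-free children families at the z-witness -/

/-- **★★★ v10's `stub_nodes13PWSVW` TEXT FROM V20-G's TWO OPEN STUB TEXTS BY NAME (`∀ F, Prop8StepCoPGAt F`, `∀ F, AbsBetaBoxAtThm1WitnessCCMGenGAt F` — the REGISTERED K0⁷ stubs 1 ∧ 3ᴬ′)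
AND THE ROAD-FREE CHILDREN FAMILIES AT `θ₁₅ᶜᶜᴹᵂᶻ(…; Efl F, logz F)`** — so by-name proofs of the two registered K0 stubs + the children families + the two β-side VW texts close K1⁹ (§3).
CONDITIONAL (every family displayed); NO stub proved; no count moved. [cite: Balaban1989LargeFieldII, Thm 1 p.355, (0.1) pp.355–356; Balaban1988Convergent, (1.15) p.249, Cor. 3 (2.50) p.264, Thm 1 p.262; Balaban1987RG1, Thm 1 p.255, Thm 3 p.264, §1 p.264; Balaban1985Variational, Thm 1 (8)–(9) p.279, Prop. 8 p.304; Balaban1985RegularSpaces, Prop. 6 p.99; Balaban1985UV3, Thm 1 p.257 + Thm 2 p.272; Balaban1989LargeFieldI, (0.2)–(0.6) p.176, Prop. 1 p.194 (bookkeeping)] -/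
theorem N24_stub_nodes13PWSVW_text_theta13OfThm1CCMWZ_doorG_of_openStubsG_of_children_boxLetters (Efl logz : (F : T4Family) → B12.RunParams → ℕ → ℝ)
    (h1G : ∀ F : T4Family, Prop8StepCoPGAt F) (h3A'G : ∀ F : T4Family, AbsBetaBoxAtThm1WitnessCCMGenGAt F)
    (h05 : ∀ (F : T4Family) {j : ℕ} {γ ε₀ ε₂₉ B₃ B₃' a₀ a₁ : ℝ} (hγ₀ : 0 < γ) (hγh : γ ≤ 1 / 2) (hε : 0 < ε₀) (hε' : 0 < ε₂₉) (hB : 0 ≤ B₃) (hB' : 0 ≤ B₃') (ha₀ : 0 < a₀) (ha₁ : 0 < a₁) {bl β' : ℝ} (hbox : BetaLowerH bl γ (betaOfRecord₁₃ F 2 (theta13OfThm1CCMWZ F 2 j γ ε₀ ε₂₉ B₃ B₃' a₀ a₁ (Efl F) (logz F)))) (hbox' : BetaUpperH β' γ (betaOfRecord₁₃ F 2 (theta13OfThm1CCMWZ F 2 j γ ε₀ ε₂₉ B₃ B₃' a₀ a₁ (Efl F) (logz F)))) (hl : -bl * γ ^ 2 ≤ 3) (hβ' : β' * γ ^ 2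 ≤ 3 / 4),
      ∃ lam8 : ResidB8 (theta13OfThm1CCMWZ F 2 j γ ε₀ ε₂₉ B₃ B₃' a₀ a₁ (Efl F) (logz F)).toStage3Params, B8LeafOfRecordSubBP (theta13OfThm1CCMWZ F 2 j γ ε₀ ε₂₉ B₃ B₃' a₀ a₁ (Efl F) (logz F)).toStage3Params lam8)
    (h06 : ∀ (F : T4Family) {j : ℕ} {γ ε₀ ε₂₉ B₃ B₃' a₀ a₁ : ℝ} (hγ₀ : 0 < γ) (hγh : γ ≤ 1 / 2) (hε : 0 < ε₀) (hε' : 0 < ε₂₉) (hB : 0 ≤ B₃) (hB' : 0 ≤ B₃') (ha₀ : 0 < a₀) (ha₁ : 0 < a₁) {bl β' : ℝ} (hbox : BetaLowerH bl γ (betaOfRecord₁₃ F 2 (theta13OfThm1CCMWZ F 2 j γ ε₀ ε₂₉ B₃ B₃' a₀ a₁ (Efl F) (logz F)))) (hbox' : BetaUpperH β' γ (betaOfRecord₁₃ F 2 (theta13OfThm1CCMWZ F 2 j γ ε₀ ε₂₉ B₃ B₃' a₀ a₁ (Efl F) (logz F)))) (hl : -bl * γ ^ 2 ≤ 3) (hβ'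 : β' * γ ^ 2 ≤ 3 / 4),
      ∃ (Mstar : ℕ) (ops : OpsY 2 (theta13OfThm1CCMWZ F 2 j γ ε₀ ε₂₉ B₃ B₃' a₀ a₁ (Efl F) (logz F)).toStage3Params Mstar), B9LeafX (Y9OfRecord 2 (theta13OfThm1CCMWZ F 2 j γ ε₀ ε₂₉ B₃ B₃' a₀ a₁ (Efl F) (logz F)).toStage3Params Mstar ops))
    (h07 : ∀ F : T4Family, ∃ ζ : ResidZ F 2, B11Leaf (Z11OfRecord F 2 ζ))
    (h08 : ∀ F : T4Family, PrintedUV3V 2 F.L)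
    (h09 : ∀ (F : T4Family) {j : ℕ} {γ ε₀ ε₂₉ B₃ B₃' a₀ a₁ : ℝ} (hγ₀ : 0 < γ) (hγh : γ ≤ 1 / 2) (hε : 0 < ε₀) (hε' : 0 < ε₂₉) (hB : 0 ≤ B₃) (hB' : 0 ≤ B₃') (ha₀ : 0 < a₀) (ha₁ : 0 < a₁) {bl β' : ℝ} (hbox : BetaLowerH bl γ (betaOfRecord₁₃ F 2 (theta13OfThm1CCMWZ F 2 j γ ε₀ ε₂₉ B₃ B₃' a₀ a₁ (Efl F) (logz F)))) (hbox' : BetaUpperH β' γ (betaOfRecord₁₃ F 2 (theta13OfThm1CCMWZ F 2 j γ ε₀ ε₂₉ B₃ B₃' a₀ a₁ (Efl F) (logz F)))) (hl : -bl * γ ^ 2 ≤ 3) (hβ' : β' * γ ^ 2 ≤ 3 / 4),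
      ∃ lam12 : ResidB12 F 2 (theta13OfThm1CCMWZ F 2 j γ ε₀ ε₂₉ B₃ B₃' a₀ a₁ (Efl F) (logz F)).τ9.M,
      ∀ P : B12.RunParams, B12Sec2to5.Lemma4Printed (F12OfRecord₁₂ F 2 (theta13OfThm1CCMWZ F 2 j γ ε₀ ε₂₉ B₃ B₃' a₀ a₁ (Efl F) (logz F)).toStage12Params lam12 P) (lam12 P).consts)
    (h09T : ∀ (F : T4Family) {j : ℕ} {γ ε₀ ε₂₉ B₃ B₃' a₀ a₁ : ℝ} (hγ₀ : 0 < γ) (hγh : γ ≤ 1 / 2) (hε : 0 < ε₀) (hε' : 0 < ε₂₉) (hB : 0 ≤ B₃) (hB' : 0 ≤ B₃') (ha₀ : 0 < a₀) (ha₁ : 0 < a₁) {bl β' : ℝ} (hbox : BetaLowerH bl γ (betaOfRecord₁₃ F 2 (theta13OfThm1CCMWZ F 2 j γ ε₀ ε₂₉ B₃ B₃' a₀ a₁ (Efl F) (logz F)))) (hbox' : BetaUpperH β' γ (betaOfRecord₁₃ F 2 (theta13OfThm1CCMWZ F 2 j γ ε₀ ε₂₉ B₃ B₃' a₀ a₁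 (Efl F) (logz F)))) (hl : -bl * γ ^ 2 ≤ 3) (hβ' : β' * γ ^ 2 ≤ 3 / 4)
      (hP : (Stage13HParams.ofHistoryBlind F 2 (Stage13RParams.ofCured F 2 (theta13OfThm1CCMWZ F 2 j γ ε₀ ε₂₉ B₃ B₃' a₀ a₁ (Efl F) (logz F)))).Provisos₁₃SepCoPH F 2),
      ∃ γ₉ : ℝ, 0 < γ₉ ∧ ∀ w : WorldP, w.C = (datumOfRecord₁₃SepCoPH F 2 (Stage13HParams.ofHistoryBlind F 2 (Stage13RParams.ofCured F 2 (theta13OfThm1CCMWZ F 2 j γ ε₀ ε₂₉ B₃ B₃' a₀ a₁ (Efl F) (logz F)))) hP).C →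
      w.γ ≤ γ₉ → ∀ P : B12.RunParams, (leavesP w P).smallCouplings → (leavesP w P).smallFieldInductive)
    (h10 : ∀ (F : T4Family) {j : ℕ} {γ ε₀ ε₂₉ B₃ B₃' a₀ a₁ : ℝ} (hγ₀ : 0 < γ) (hγh : γ ≤ 1 / 2) (hε : 0 < ε₀) (hε' : 0 < ε₂₉) (hB : 0 ≤ B₃) (hB' : 0 ≤ B₃') (ha₀ : 0 < a₀) (ha₁ : 0 < a₁) {bl β' : ℝ} (hbox : BetaLowerH bl γ (betaOfRecord₁₃ F 2 (theta13OfThm1CCMWZ F 2 j γ ε₀ ε₂₉ B₃ B₃' a₀ a₁ (Efl F) (logz F)))) (hbox' : BetaUpperH β' γ (betaOfRecord₁₃ F 2 (theta13OfThm1CCMWZ F 2 j γ ε₀ ε₂₉ B₃ B₃' a₀ a₁ (Efl F) (logz F)))) (hl : -bl * γ ^ 2 ≤ 3) (hβ' : β' * γ ^ 2 ≤ 3 / 4),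
      ∃ lam13 : B12.RunParams → ResidB13 (theta13OfThm1CCMWZ F 2 j γ ε₀ ε₂₉ B₃ B₃' a₀ a₁ (Efl F) (logz F)).toStage3Params,
      ∀ P : B12.RunParams, B13LeafOfRecord (theta13OfThm1CCMWZ F 2 j γ ε₀ ε₂₉ B₃ B₃' a₀ a₁ (Efl F) (logz F)).toStage3Params (lam13 P))
    (h11 : ∀ (F : T4Family) {j : ℕ} {γ ε₀ ε₂₉ B₃ B₃' a₀ a₁ : ℝ} (hγ₀ : 0 < γ) (hγh : γ ≤ 1 / 2) (hε : 0 < ε₀) (hε' : 0 < ε₂₉) (hB : 0 ≤ B₃) (hB' : 0 ≤ B₃') (ha₀ : 0 < a₀) (ha₁ : 0 < a₁) {bl β' : ℝ} (hbox : BetaLowerH bl γ (betaOfRecord₁₃ F 2 (theta13OfThm1CCMWZ F 2 j γ ε₀ ε₂₉ B₃ B₃' a₀ a₁ (Efl F) (logz F)))) (hbox' : BetaUpperH β' γ (betaOfRecord₁₃ F 2 (theta13OfThm1CCMWZ F 2 j γ ε₀ ε₂₉ B₃ B₃' a₀ a₁ (Efl F) (logz F)))) (hl : -bl * γ ^ 2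 ≤ 3) (hβ' : β' * γ ^ 2 ≤ 3 / 4)
      (hP : (Stage13HParams.ofHistoryBlind F 2 (Stage13RParams.ofCured F 2 (theta13OfThm1CCMWZ F 2 j γ ε₀ ε₂₉ B₃ B₃' a₀ a₁ (Efl F) (logz F)))).Provisos₁₃SepCoPH F 2),
      ∀ βup β₀ : ℝ, ∃ γ₁₁ : ℝ, 0 < γ₁₁ ∧ ∀ w : WorldP, w.C = (datumOfRecord₁₃SepCoPH F 2 (Stage13HParams.ofHistoryBlind F 2 (Stage13RParams.ofCured F 2 (theta13OfThm1CCMWZ F 2 j γ ε₀ ε₂₉ B₃ B₃' a₀ a₁ (Efl F) (logz F)))) hP).C →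
      w.βup = βup → w.β₀ = β₀ → w.γ ≤ γ₁₁ → ∀ P : B12.RunParams, (leavesP w P).b7 → (leavesP w P).b8 → (leavesP w P).b9 → (leavesP w P).b10 → (leavesP w P).b11 →
      (leavesP w P).smallCouplings → (leavesP w P).smallFieldInductive → (leavesP w P).flowControl →
        ∀ k, k < P.K → SLaw₁₃CoPH F 2 (Stage13HParams.ofHistoryBlind F 2 (Stage13RParams.ofCured F 2 (theta13OfThm1CCMWZ F 2 j γ ε₀ ε₂₉ B₃ B₃' a₀ a₁ (Efl F) (logz F)))) P k → TLaw₁₃CoPH F 2 (Stage13HParams.ofHistoryBlind F 2 (Stage13RParams.ofCured F 2 (theta13OfThm1CCMWZ F 2 j γ ε₀ ε₂₉ B₃ B₃' a₀ a₁ (Efl F) (logz F)))) P k)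
    (h12 : ∀ (F : T4Family) {j : ℕ} {γ ε₀ ε₂₉ B₃ B₃' a₀ a₁ : ℝ} (hγ₀ : 0 < γ) (hγh : γ ≤ 1 / 2) (hε : 0 < ε₀) (hε' : 0 < ε₂₉) (hB : 0 ≤ B₃) (hB' : 0 ≤ B₃') (ha₀ : 0 < a₀) (ha₁ : 0 < a₁) {bl β' : ℝ} (hbox : BetaLowerH bl γ (betaOfRecord₁₃ F 2 (theta13OfThm1CCMWZ F 2 j γ ε₀ ε₂₉ B₃ B₃' a₀ a₁ (Efl F) (logz F)))) (hbox' : BetaUpperH β' γ (betaOfRecord₁₃ F 2 (theta13OfThm1CCMWZ F 2 j γ ε₀ ε₂₉ B₃ B₃' a₀ a₁ (Efl F) (logz F)))) (hl : -bl * γ ^ 2 ≤ 3) (hβ' : β' * γ ^ 2 ≤ 3 / 4),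
      ∃ lamW : ResidW F 2, (∀ P : B12.RunParams, B15Leaf (WOfRecord₁₃ F 2 (theta13OfThm1CCMWZ F 2 j γ ε₀ ε₂₉ B₃ B₃' a₀ a₁ (Efl F) (logz F)) lamW P)) ∧
      ∀ P : B12.RunParams, 1 ≤ P.K → lamW.kSel P < P.K)
    (h13 : ∀ (F : T4Family) {j : ℕ} {γ ε₀ ε₂₉ B₃ B₃' a₀ a₁ : ℝ} (hγ₀ : 0 < γ) (hγh : γ ≤ 1 / 2) (hε : 0 < ε₀) (hε' : 0 < ε₂₉) (hB : 0 ≤ B₃) (hB' : 0 ≤ B₃') (ha₀ : 0 < a₀) (ha₁ : 0 < a₁) {bl β' : ℝ} (hbox : BetaLowerH bl γ (betaOfRecord₁₃ F 2 (theta13OfThm1CCMWZ F 2 j γ ε₀ ε₂₉ B₃ B₃' a₀ a₁ (Efl F) (logz F)))) (hbox' : BetaUpperH β' γ (betaOfRecord₁₃ F 2 (theta13OfThm1CCMWZ F 2 j γ ε₀ ε₂₉ B₃ B₃' a₀ a₁ (Efl F) (logz F)))) (hl : -bl * γ ^ 2 ≤ 3) (hβ' : β' * γ ^ 2 ≤ 3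 / 4)
      (hP : (Stage13HParams.ofHistoryBlind F 2 (Stage13RParams.ofCured F 2 (theta13OfThm1CCMWZ F 2 j γ ε₀ ε₂₉ B₃ B₃' a₀ a₁ (Efl F) (logz F)))).Provisos₁₃SepCoPH F 2),
      ∃ γ₁₃ : ℝ, 0 < γ₁₃ ∧ ∃ em ep : ℝ → ℝ, ∃ v : Revision₁₃ F 2 (Stage13HParams.ofHistoryBlind F 2 (Stage13RParams.ofCured F 2 (theta13OfThm1CCMWZ F 2 j γ ε₀ ε₂₉ B₃ B₃' a₀ a₁ (Efl F) (logz F)))) hP,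
      ∀ P : B12.RunParams, (genFlow (betaOfRecord₁₃ F 2 (theta13OfThm1CCMWZ F 2 j γ ε₀ ε₂₉ B₃ B₃' a₀ a₁ (Efl F) (logz F))) P.g0).InInterval γ₁₃ P.K → ∀ k, k ≤ P.K → SLaw₁₃CoPH F 2 (Stage13HParams.ofHistoryBlind F 2 (Stage13RParams.ofCured F 2 (theta13OfThm1CCMWZ F 2 j γ ε₀ ε₂₉ B₃ B₃' a₀ a₁ (Efl F) (logz F)))) P k →
      ∀ U : GaugeField (F.P P.K) k (SU 2),
        chiβOfRecord₁₃ F 2 (theta13OfThm1CCMWZ F 2 j γ ε₀ ε₂₉ B₃ B₃' a₀ a₁ (Efl F) (logz F)) P.K (gOfRecord₁₃ F 2 (theta13OfThm1CCMWZ F 2 j γ ε₀ ε₂₉ B₃ B₃' a₀ a₁ (Efl F) (logz F)) P) k U *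
              Real.exp (-(1 / (gOfRecord₁₃ F 2 (theta13OfThm1CCMWZ F 2 j γ ε₀ ε₂₉ B₃ B₃' a₀ a₁ (Efl F) (logz F)) P k) ^ 2 * wilsonBGOfRecord F 2 (theta13OfThm1CCMWZ F 2 j γ ε₀ ε₂₉ B₃ B₃' a₀ a₁ (Efl F) (logz F)).εbg P k U)
                - em (gOfRecord₁₃ F 2 (theta13OfThm1CCMWZ F 2 j γ ε₀ ε₂₉ B₃ B₃' a₀ a₁ (Efl F) (logz F)) P k) * (Fintype.card (Site (F.P P.K) k) : ℝ)) ≤ v.ρ P k U ∧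
        v.ρ P k U ≤ Real.exp (ep (gOfRecord₁₃ F 2 (theta13OfThm1CCMWZ F 2 j γ ε₀ ε₂₉ B₃ B₃' a₀ a₁ (Efl F) (logz F)) P k) * (Fintype.card (Site (F.P P.K) k) : ℝ))) :
    ∀ F : T4Family, Inhabited13 F → NodesAtSomeRecord13PWSVW F :=
  fun F _ => N24_nodesAtSomeRecord13PWSVW_byName_theta13OfThm1CCMWZ_doorG_of_stub1G_stub3A'G_of_children_boxLetters (Efl F) (logz F) (h1G F) (h3A'G F)
    (h05 F) (h06 F) (h07 F) (h08 F) (h09 F) (h09T F) (h10 F) (h11 F) (h12 F) (h13 F)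

/-! ## §3. ★★★ K1⁹ BY NAME: §2 + the two registered β-side LINE-2′ stub texts, through the W-END road -/

/-- **★★★ THE DECIDING CRUX BY NAME FROM V20-G's K0 TEXTS, THE ROAD-FREE CHILDREN FAMILIES AT THE z-WITNESS AND THE TWO β-SIDE VW TEXTS** (`h₂` = `stub_runRows13PWSVW`'s text, `h₃` =
`stub_cont13VW`'s).  CONDITIONAL; K1⁹ OPEN; no count moved. [cite: Balaban1989LargeFieldII, Thm 1 p.355 + (0.1) pp.355–356; Balaban1987RG1, (0.15) p.254, Thm 3 p.264, (5.10) p.293, §1 pp.263–264; Balaban1988Convergent, (1.15) p.249, Cor. 3 (2.50) p.264 (bookkeeping)] -/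
theorem N24_stabilityBRunRowsAtRecordR13SepCoPHV_byName_theta13OfThm1CCMWZ_doorG_of_openStubsG_of_children_boxLetters_of_stub2VW_stub3VW (Efl logz : (F : T4Family) → B12.RunParams → ℕ → ℝ)
    (h1G : ∀ F : T4Family, Prop8StepCoPGAt F) (h3A'G : ∀ F : T4Family, AbsBetaBoxAtThm1WitnessCCMGenGAt F)
    (h05 : ∀ (F : T4Family) {j : ℕ} {γ ε₀ ε₂₉ B₃ B₃' a₀ a₁ : ℝ} (hγ₀ : 0 < γ) (hγh : γ ≤ 1 / 2) (hε : 0 < ε₀) (hε' : 0 < ε₂₉) (hB : 0 ≤ B₃) (hB' : 0 ≤ B₃') (ha₀ : 0 < a₀) (ha₁ : 0 < a₁) {bl β' : ℝ} (hbox : BetaLowerH bl γ (betaOfRecord₁₃ F 2 (theta13OfThm1CCMWZ F 2 j γ ε₀ ε₂₉ B₃ B₃' a₀ a₁ (Efl F) (logz F)))) (hbox' : BetaUpperH β' γ (betaOfRecord₁₃ F 2 (theta13OfThm1CCMWZ F 2 j γ ε₀ ε₂₉ B₃ B₃' a₀ a₁ (Efl F) (logz F)))) (hl : -bl * γ ^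 2 ≤ 3) (hβ' : β' * γ ^ 2 ≤ 3 / 4),
      ∃ lam8 : ResidB8 (theta13OfThm1CCMWZ F 2 j γ ε₀ ε₂₉ B₃ B₃' a₀ a₁ (Efl F) (logz F)).toStage3Params, B8LeafOfRecordSubBP (theta13OfThm1CCMWZ F 2 j γ ε₀ ε₂₉ B₃ B₃' a₀ a₁ (Efl F) (logz F)).toStage3Params lam8)
    (h06 : ∀ (F : T4Family) {j : ℕ} {γ ε₀ ε₂₉ B₃ B₃' a₀ a₁ : ℝ} (hγ₀ : 0 < γ) (hγh : γ ≤ 1 / 2) (hε : 0 < ε₀) (hε' : 0 < ε₂₉) (hB : 0 ≤ B₃) (hB' : 0 ≤ B₃') (ha₀ : 0 < a₀) (ha₁ : 0 < a₁) {bl β' : ℝ} (hbox : BetaLowerH bl γ (betaOfRecord₁₃ F 2 (theta13OfThm1CCMWZ F 2 j γ ε₀ ε₂₉ B₃ B₃' a₀ a₁ (Efl F) (logz F)))) (hbox' : BetaUpperH β' γ (betaOfRecord₁₃ F 2 (theta13OfThm1CCMWZ F 2 j γ ε₀ ε₂₉ B₃ B₃' a₀ a₁ (Efl F) (logz F))))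 (hl : -bl * γ ^ 2 ≤ 3) (hβ' : β' * γ ^ 2 ≤ 3 / 4),
      ∃ (Mstar : ℕ) (ops : OpsY 2 (theta13OfThm1CCMWZ F 2 j γ ε₀ ε₂₉ B₃ B₃' a₀ a₁ (Efl F) (logz F)).toStage3Params Mstar), B9LeafX (Y9OfRecord 2 (theta13OfThm1CCMWZ F 2 j γ ε₀ ε₂₉ B₃ B₃' a₀ a₁ (Efl F) (logz F)).toStage3Params Mstar ops))
    (h07 : ∀ F : T4Family, ∃ ζ : ResidZ F 2, B11Leaf (Z11OfRecord F 2 ζ))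
    (h08 : ∀ F : T4Family, PrintedUV3V 2 F.L)
    (h09 : ∀ (F : T4Family) {j : ℕ} {γ ε₀ ε₂₉ B₃ B₃' a₀ a₁ : ℝ} (hγ₀ : 0 < γ) (hγh : γ ≤ 1 / 2) (hε : 0 < ε₀) (hε' : 0 < ε₂₉) (hB : 0 ≤ B₃) (hB' : 0 ≤ B₃') (ha₀ : 0 < a₀) (ha₁ : 0 < a₁) {bl β' : ℝ} (hbox : BetaLowerH bl γ (betaOfRecord₁₃ F 2 (theta13OfThm1CCMWZ F 2 j γ ε₀ ε₂₉ B₃ B₃' a₀ a₁ (Efl F) (logz F)))) (hbox' : BetaUpperH β' γ (betaOfRecord₁₃ F 2 (theta13OfThm1CCMWZ F 2 j γ ε₀ ε₂₉ B₃ B₃' a₀ a₁ (Efl F) (logz F)))) (hl : -bl * γ ^ 2 ≤ 3) (hβ' : β' * γ ^ 2 ≤ 3 / 4),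
      ∃ lam12 : ResidB12 F 2 (theta13OfThm1CCMWZ F 2 j γ ε₀ ε₂₉ B₃ B₃' a₀ a₁ (Efl F) (logz F)).τ9.M,
      ∀ P : B12.RunParams, B12Sec2to5.Lemma4Printed (F12OfRecord₁₂ F 2 (theta13OfThm1CCMWZ F 2 j γ ε₀ ε₂₉ B₃ B₃' a₀ a₁ (Efl F) (logz F)).toStage12Params lam12 P) (lam12 P).consts)
    (h09T : ∀ (F : T4Family) {j : ℕ} {γ ε₀ ε₂₉ B₃ B₃' a₀ a₁ : ℝ} (hγ₀ : 0 < γ) (hγh : γ ≤ 1 / 2) (hε : 0 < ε₀) (hε' : 0 < ε₂₉) (hB : 0 ≤ B₃) (hB' : 0 ≤ B₃') (ha₀ : 0 < a₀) (ha₁ : 0 < a₁) {bl β' : ℝ} (hbox : BetaLowerH bl γ (betaOfRecord₁₃ F 2 (theta13OfThm1CCMWZ F 2 j γ ε₀ ε₂₉ B₃ B₃' a₀ a₁ (Efl F) (logz F)))) (hbox' : BetaUpperH β' γ (betaOfRecord₁₃ F 2 (theta13OfThm1CCMWZ F 2 j γ ε₀ ε₂₉ B₃ B₃' a₀ a₁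 (Efl F) (logz F)))) (hl : -bl * γ ^ 2 ≤ 3) (hβ' : β' * γ ^ 2 ≤ 3 / 4)
      (hP : (Stage13HParams.ofHistoryBlind F 2 (Stage13RParams.ofCured F 2 (theta13OfThm1CCMWZ F 2 j γ ε₀ ε₂₉ B₃ B₃' a₀ a₁ (Efl F) (logz F)))).Provisos₁₃SepCoPH F 2),
      ∃ γ₉ : ℝ, 0 < γ₉ ∧ ∀ w : WorldP, w.C = (datumOfRecord₁₃SepCoPH F 2 (Stage13HParams.ofHistoryBlind F 2 (Stage13RParams.ofCured F 2 (theta13OfThm1CCMWZ F 2 j γ ε₀ ε₂₉ B₃ B₃' a₀ a₁ (Efl F) (logz F)))) hP).C →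
      w.γ ≤ γ₉ → ∀ P : B12.RunParams, (leavesP w P).smallCouplings → (leavesP w P).smallFieldInductive)
    (h10 : ∀ (F : T4Family) {j : ℕ} {γ ε₀ ε₂₉ B₃ B₃' a₀ a₁ : ℝ} (hγ₀ : 0 < γ) (hγh : γ ≤ 1 / 2) (hε : 0 < ε₀) (hε' : 0 < ε₂₉) (hB : 0 ≤ B₃) (hB' : 0 ≤ B₃') (ha₀ : 0 < a₀) (ha₁ : 0 < a₁) {bl β' : ℝ} (hbox : BetaLowerH bl γ (betaOfRecord₁₃ F 2 (theta13OfThm1CCMWZ F 2 j γ ε₀ ε₂₉ B₃ B₃' a₀ a₁ (Efl F) (logz F)))) (hbox' : BetaUpperH β' γ (betaOfRecord₁₃ F 2 (theta13OfThm1CCMWZ F 2 j γ ε₀ ε₂₉ B₃ B₃' a₀ a₁ (Efl F) (logz F)))) (hl : -bl * γ ^ 2 ≤ 3) (hβ' : β' * γ ^ 2 ≤ 3 / 4),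
      ∃ lam13 : B12.RunParams → ResidB13 (theta13OfThm1CCMWZ F 2 j γ ε₀ ε₂₉ B₃ B₃' a₀ a₁ (Efl F) (logz F)).toStage3Params,
      ∀ P : B12.RunParams, B13LeafOfRecord (theta13OfThm1CCMWZ F 2 j γ ε₀ ε₂₉ B₃ B₃' a₀ a₁ (Efl F) (logz F)).toStage3Params (lam13 P))
    (h11 : ∀ (F : T4Family) {j : ℕ} {γ ε₀ ε₂₉ B₃ B₃' a₀ a₁ : ℝ} (hγ₀ : 0 < γ) (hγh : γ ≤ 1 / 2) (hε : 0 < ε₀) (hε' : 0 < ε₂₉) (hB : 0 ≤ B₃) (hB' : 0 ≤ B₃') (ha₀ : 0 < a₀) (ha₁ : 0 < a₁) {bl β' : ℝ} (hbox : BetaLowerH bl γ (betaOfRecord₁₃ F 2 (theta13OfThm1CCMWZ F 2 j γ ε₀ ε₂₉ B₃ B₃' a₀ a₁ (Efl F) (logz F)))) (hbox' : BetaUpperH β' γ (betaOfRecord₁₃ F 2 (theta13OfThm1CCMWZ F 2 j γ ε₀ ε₂₉ B₃ B₃' a₀ a₁ (Efl F) (logz F)))) (hl : -bl * γ ^ 2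 ≤ 3) (hβ' : β' * γ ^ 2 ≤ 3 / 4)
      (hP : (Stage13HParams.ofHistoryBlind F 2 (Stage13RParams.ofCured F 2 (theta13OfThm1CCMWZ F 2 j γ ε₀ ε₂₉ B₃ B₃' a₀ a₁ (Efl F) (logz F)))).Provisos₁₃SepCoPH F 2),
      ∀ βup β₀ : ℝ, ∃ γ₁₁ : ℝ, 0 < γ₁₁ ∧ ∀ w : WorldP, w.C = (datumOfRecord₁₃SepCoPH F 2 (Stage13HParams.ofHistoryBlind F 2 (Stage13RParams.ofCured F 2 (theta13OfThm1CCMWZ F 2 j γ ε₀ ε₂₉ B₃ B₃' a₀ a₁ (Efl F) (logz F)))) hP).C →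
      w.βup = βup → w.β₀ = β₀ → w.γ ≤ γ₁₁ → ∀ P : B12.RunParams, (leavesP w P).b7 → (leavesP w P).b8 → (leavesP w P).b9 → (leavesP w P).b10 → (leavesP w P).b11 →
      (leavesP w P).smallCouplings → (leavesP w P).smallFieldInductive → (leavesP w P).flowControl →
        ∀ k, k < P.K → SLaw₁₃CoPH F 2 (Stage13HParams.ofHistoryBlind F 2 (Stage13RParams.ofCured F 2 (theta13OfThm1CCMWZ F 2 j γ ε₀ ε₂₉ B₃ B₃' a₀ a₁ (Efl F) (logz F)))) P k → TLaw₁₃CoPH F 2 (Stage13HParams.ofHistoryBlind F 2 (Stage13RParams.ofCured F 2 (theta13OfThm1CCMWZ F 2 j γ ε₀ ε₂₉ B₃ B₃' a₀ a₁ (Efl F) (logz F)))) P k)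
    (h12 : ∀ (F : T4Family) {j : ℕ} {γ ε₀ ε₂₉ B₃ B₃' a₀ a₁ : ℝ} (hγ₀ : 0 < γ) (hγh : γ ≤ 1 / 2) (hε : 0 < ε₀) (hε' : 0 < ε₂₉) (hB : 0 ≤ B₃) (hB' : 0 ≤ B₃') (ha₀ : 0 < a₀) (ha₁ : 0 < a₁) {bl β' : ℝ} (hbox : BetaLowerH bl γ (betaOfRecord₁₃ F 2 (theta13OfThm1CCMWZ F 2 j γ ε₀ ε₂₉ B₃ B₃' a₀ a₁ (Efl F) (logz F)))) (hbox' : BetaUpperH β' γ (betaOfRecord₁₃ F 2 (theta13OfThm1CCMWZ F 2 j γ ε₀ ε₂₉ B₃ B₃' a₀ a₁ (Efl F) (logz F)))) (hl : -bl * γ ^ 2 ≤ 3) (hβ' : β' * γ ^ 2 ≤ 3 / 4),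
      ∃ lamW : ResidW F 2, (∀ P : B12.RunParams, B15Leaf (WOfRecord₁₃ F 2 (theta13OfThm1CCMWZ F 2 j γ ε₀ ε₂₉ B₃ B₃' a₀ a₁ (Efl F) (logz F)) lamW P)) ∧
      ∀ P : B12.RunParams, 1 ≤ P.K → lamW.kSel P < P.K)
    (h13 : ∀ (F : T4Family) {j : ℕ} {γ ε₀ ε₂₉ B₃ B₃' a₀ a₁ : ℝ} (hγ₀ : 0 < γ) (hγh : γ ≤ 1 / 2) (hε : 0 < ε₀) (hε' : 0 < ε₂₉) (hB : 0 ≤ B₃) (hB' : 0 ≤ B₃') (ha₀ : 0 < a₀) (ha₁ : 0 < a₁) {bl β' : ℝ} (hbox : BetaLowerH bl γ (betaOfRecord₁₃ F 2 (theta13OfThm1CCMWZ F 2 j γ ε₀ ε₂₉ B₃ B₃' a₀ a₁ (Efl F) (logz F)))) (hbox' : BetaUpperH β' γ (betaOfRecord₁₃ F 2 (theta13OfThm1CCMWZ F 2 j γ ε₀ ε₂₉ B₃ B₃' a₀ a₁ (Efl F) (logz F)))) (hl : -bl * γ ^ 2 ≤ 3) (hβ' : β' * γ ^ 2 ≤ 3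 / 4)
      (hP : (Stage13HParams.ofHistoryBlind F 2 (Stage13RParams.ofCured F 2 (theta13OfThm1CCMWZ F 2 j γ ε₀ ε₂₉ B₃ B₃' a₀ a₁ (Efl F) (logz F)))).Provisos₁₃SepCoPH F 2),
      ∃ γ₁₃ : ℝ, 0 < γ₁₃ ∧ ∃ em ep : ℝ → ℝ, ∃ v : Revision₁₃ F 2 (Stage13HParams.ofHistoryBlind F 2 (Stage13RParams.ofCured F 2 (theta13OfThm1CCMWZ F 2 j γ ε₀ ε₂₉ B₃ B₃' a₀ a₁ (Efl F) (logz F)))) hP,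
      ∀ P : B12.RunParams, (genFlow (betaOfRecord₁₃ F 2 (theta13OfThm1CCMWZ F 2 j γ ε₀ ε₂₉ B₃ B₃' a₀ a₁ (Efl F) (logz F))) P.g0).InInterval γ₁₃ P.K → ∀ k, k ≤ P.K → SLaw₁₃CoPH F 2 (Stage13HParams.ofHistoryBlind F 2 (Stage13RParams.ofCured F 2 (theta13OfThm1CCMWZ F 2 j γ ε₀ ε₂₉ B₃ B₃' a₀ a₁ (Efl F) (logz F)))) P k →
      ∀ U : GaugeField (F.P P.K) k (SU 2),
        chiβOfRecord₁₃ F 2 (theta13OfThm1CCMWZ F 2 j γ ε₀ ε₂₉ B₃ B₃' a₀ a₁ (Efl F) (logz F)) P.K (gOfRecord₁₃ F 2 (theta13OfThm1CCMWZ F 2 j γ ε₀ ε₂₉ B₃ B₃' a₀ a₁ (Efl F) (logz F)) P) k U *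
              Real.exp (-(1 / (gOfRecord₁₃ F 2 (theta13OfThm1CCMWZ F 2 j γ ε₀ ε₂₉ B₃ B₃' a₀ a₁ (Efl F) (logz F)) P k) ^ 2 * wilsonBGOfRecord F 2 (theta13OfThm1CCMWZ F 2 j γ ε₀ ε₂₉ B₃ B₃' a₀ a₁ (Efl F) (logz F)).εbg P k U)
                - em (gOfRecord₁₃ F 2 (theta13OfThm1CCMWZ F 2 j γ ε₀ ε₂₉ B₃ B₃' a₀ a₁ (Efl F) (logz F)) P k) * (Fintype.card (Site (F.P P.K) k) : ℝ)) ≤ v.ρ P k U ∧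
        v.ρ P k U ≤ Real.exp (ep (gOfRecord₁₃ F 2 (theta13OfThm1CCMWZ F 2 j γ ε₀ ε₂₉ B₃ B₃' a₀ a₁ (Efl F) (logz F)) P k) * (Fintype.card (Site (F.P P.K) k) : ℝ)))
    (h₂ : ∀ F : T4Family, NodesAtSomeRecord13PWSVW F → RunRowsAtSomeRecord13PWSVW F)
    (h₃ : ∀ F : T4Family, RunRowsAtSomeRecord13PWSVW F → RunRowsContAtSomeRecord13PWSVW F) :
    Summit.QuantumFields.YangMills.Theses.BalabanUVNodes.StabilityBRunRowsAtRecordR13SepCoPHV :=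
  stabilityBRunRowsAtRecordR13SepCoPHV_of_stubTextsVW
    (N24_stub_nodes13PWSVW_text_theta13OfThm1CCMWZ_doorG_of_openStubsG_of_children_boxLetters Efl logz h1G h3A'G h05 h06 h07 h08 h09 h09T h10 h11 h12 h13) h₂ h₃

end Summit.QuantumFields.YangMills.BalabanUVNodes.N24LineTwoRung1AtThm1CCMWZDoorGOfChildrenBoxLetters

end
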